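/-
Copyright: the b2b-balaban cell (near-miss cell 7), T⁴-continuum CRUX team (coordinator ruling e34b3e0c item (2)),
seat t4-ne7b-formalise-leaf-05 (gen 26). Released under the licence of the surrounding project.
-/
import Summits.QuantumFields.BalabanUV.T4Continuum.Spine.NE7b.CovariantDivergenceEL
import Literature.MathematicalPhysics.QuantumFieldTheory.Balaban1983to89.T4TreeGaugeNoPrescriptionSU2
import Mathlib.Analysis.Calculus.LocalExtr.Basic
import Mathlib.Analysis.SpecialFunctions.Trigonometric.Deriv

/-!
# One-link minimisers of the Wilson action satisfy the lattice Yang–Mills equation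
# (route NE7b R-H, `t4/ROUTES-NE7b.md` v5 §2 PH-k (β): «critical in every free link (a fortiori the minimiser)»)

Cell `pub-balaban`, sub-cell `t4`, spine estimate NE7b (node U5c), candidate route R-H «Peierls healing map», lemma PH-k
(discrete Bochner–Weitzenböck barrier for the interior-free `SU(2)` minimiser; ROUTES-NE7b v5 §2, seat `t4-ne7b-idea-1`
gen 5; refuter's PRICING-NE7b v5 F23c). PH-k's four facts (β₁)–(β₄) are stated for «a configuration that is CRITICAL
IN EVERY FREE LINK (a fortiori the minimiser `U_Ω(e)`)». The kernel has (β₁) in TANGENT form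
(`QuaternionBianchiDefect.critical_iff_im_eq_zero`, p253069: `∀ X pure imaginary, Re((X·U₀)·S) = 0 ↔ Im(U₀·S) = 0`) and
its lattice reading (`CovariantDivergenceEL.critical_iff_covDiv_eq_zero`, leaf-06 g28: `… ↔ covDiv U x i = 0`, with
`Re(U(x,i)·S(x,i)) =` the Wilson plaquettes through the link, `re_mul_staple`). THIS FILE supplies the «a fortiori»:
a link variable that MINIMISES the Wilson action of the plaquettes through its link (globally, or only locally on the
group `S³`), the other links frozen, IS critical in that tangent sense — hence the covariant divergence of the
sine-curvature vanishes at that link. Law-free; Mathlib calculus + the two files above.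

CONTENTS (`G :=` unit quaternions `Metric.sphere (0 : ℍ) 1`, as in `QuaternionBianchiDefect` §6).
* §1 norm facts in `ℍ` (on top of the tree's `‖q‖² = (Re q)² + ‖Im q‖²`, `T4TreeGaugeNoPrescriptionSU2`, and
  `‖q‖² = Σ squares`, `SU2HaarSmallBall`, imported BY NAME): `Re q ≤ ‖q‖`, `Im q = 0` once `‖q‖ ≤ Re q`,
  `Re(V·S) ≤ ‖S‖` for unit `V`, `Re(S*·S) = ‖S‖²`.
* §2 **GLOBAL** one-link maximiser — `el_of_forall_re_mul_le`: if the unit quaternion `U₀` maximises `V ↦ Re(V·S)` over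
  the unit sphere then `Re(U₀·S) = ‖S‖` and `Im(U₀·S) = 0` (norm argument: the maximum `‖S‖` is attained at `S*∕‖S‖`,
  and `Re q = ‖q‖` forces `Im q = 0`). No calculus.
* §3 **LOCAL** one-link maximiser — `tangentCritical_of_isLocalMaxOn_sphere`: if `U₀` is a LOCAL maximiser of
  `V ↦ Re(V·S)` on the sphere (`IsLocalMaxOn`), then `Re((X·U₀)·S) = 0` for every pure imaginary `X` (differentiate
  along the great circle `t ↦ (cos t + sin t·X̂)·U₀`, `IsLocalMax.hasDerivAt_eq_zero`); hence `Im(U₀·S) = 0`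
  (`im_eq_zero_of_isLocalMaxOn_sphere`, via (β₁)). A subtype version (`IsLocalMax` on `↥(sphere 0 1)`) is derived.
* §4 **ON THE LATTICE** (`U : ZdGaugeConfig d G`, link `(x,i)`): `plaqReThrough U x i := Σ_{k≠i} [Re P_{ik}(x) +
  Re P_{ik}(x−e_k)]` (the Wilson functional of the `2(d−1)` plaquettes through the link; `= Re(U(x,i)·S(x,i))` by
  `re_mul_staple`) and `actionThrough := Σ_{k≠i} [(1 − Re P_{ik}(x)) + (1 − Re P_{ik}(x−e_k))]`; replacing the link value by
  `V` gives `Re(V·S(x,i))` (`plaqReThrough_update`, from `staple_update`). **`covDiv_eq_zero_of_forall_actionThrough_le`**: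
  if no value of the link variable lowers `actionThrough` (a GLOBAL one-link minimiser — in particular any minimiser of
  the Wilson action over a set of free links containing `(x,i)`, the rest frozen), then `covDiv U x i = 0` AND
  `Re(U(x,i)·S) = ‖S‖`; **`covDiv_eq_zero_of_isLocalMin_actionThrough`**: the same conclusion `covDiv U x i = 0` for a
  LOCAL one-link minimiser on `G`.

HONEST FRAMING. Law-free facts about ONE lattice configuration (no measure, no effective action, no small-field
hypothesis); nothing of (β₄)'s constant, of (MP<L²)'s envelope∕window, of PH-c⁺ or of [Bałaban 1983–89] is asserted or
cited; the `specialUnitaryGroup (Fin 2) ℂ ≃` unit-quaternion bridge is NOT formalised here. NE7b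
(`T4WeightBudget.RelWeightBound`) NOT PRINTED, NOT PROVED; spine PROVED 0∕9; rung (B)+1 on a FINITE torus T⁴ — NOT
infinite volume, NOT the mass gap, NOT Clay. HONEST DEPENDENCY: continuum YM on T⁴ ⇐ BetaPertH ∧ nine spine estimates
(0/9 proved); BetaPertH ⇐ (D1) ∧ (D4) ∧ CAP+tail; G-an2-4 gates asym, D1 and NE2/3/4. POLICY: crux-route work under
`Spine/NE7b/` (coordinator FREEZE (0) respected: not a `T4Continuum/Support` leaf, not a folklore-algebra module — it is
the entry step of ROUTES v5's named item PH-k for the minimiser); two concrete `ℝ`-valued definitions (`plaqReThrough`,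
`actionThrough`), no `Prop`-valued fact, no `[cite:]` fact.
-/

set_option autoImplicit false

namespace Summit.QuantumFields.BalabanUV.T4Continuum.NE7b.LinkMinimiserEL

noncomputable section

open Quaternion
open scoped Quaternion
open Filter Topology
open Literature.MathematicalPhysics.QuantumFieldTheory (ZdEdge ZdGaugeConfig)
open Literature.Probability.LatticeModels (Site)
open Literature.MathematicalPhysics.QuantumLattice (sq_norm_eq_sum_sq)
open Literature.MathematicalPhysics.QuantumFieldTheory.Balaban1983to89.T4TreeGaugeNoPrescriptionSU2
  (norm_sq_eq_re_sq_add_norm_im_sq)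
open Summit.QuantumFields.BalabanUV.T4Continuum.NE7b.QuaternionBianchiDefect (critical_iff_im_eq_zero norm_coe_sphere)
open Summit.QuantumFields.BalabanUV.T4Continuum.NE7b.CovariantDivergenceEL
  (staple covDiv re_mul_staple im_mul_staple staple_update critical_iff_covDiv_eq_zero)

/-! ## §1 Norm facts in `ℍ` -/

-- `‖q‖² = (Re q)² + ‖Im q‖²` is the tree's `T4TreeGaugeNoPrescriptionSU2.norm_sq_eq_re_sq_add_norm_im_sq` and
-- `‖q‖² = (Re q)² + (Im_I q)² + (Im_J q)² + (Im_K q)²` the tree's `QuantumLattice.sq_norm_eq_sum_sq` (imported, not restated).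

/-- `Re q ≤ ‖q‖`. -/
theorem re_le_norm (q : ℍ) : q.re ≤ ‖q‖ := by
  have h := norm_sq_eq_re_sq_add_norm_im_sq q
  nlinarith [norm_nonneg q, sq_nonneg ‖q.im‖, sq_nonneg (q.re - ‖q‖), sq_nonneg (q.re + ‖q‖)]

/-- If `‖q‖ ≤ Re q` (hence `=`), then `q` is real: `Im q = 0`. -/
theorem im_eq_zero_of_norm_le_re (q : ℍ) (h : ‖q‖ ≤ q.re) : q.im = 0 := by
  have h1 := norm_sq_eq_re_sq_add_norm_im_sq q
  have h0 : 0 ≤ ‖q‖ := norm_nonneg q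
  have h2 : ‖q.im‖ ^ 2 ≤ 0 := by nlinarith [re_le_norm q]
  have h3 : ‖q.im‖ = 0 := by nlinarith [norm_nonneg q.im]
  exact norm_eq_zero.mp h3

/-- `Re(V·S) ≤ ‖S‖` for a unit quaternion `V`. -/
theorem re_mul_le_norm (V S : ℍ) (hV : ‖V‖ = 1) : (V * S).re ≤ ‖S‖ :=
  (re_le_norm _).trans (by rw [norm_mul, hV, one_mul])

/-- `Re(S*·S) = ‖S‖²`. -/
theorem re_star_mul_self (S : ℍ) : (star S * S).re = ‖S‖ ^ 2 := by
  rw [Quaternion.star_mul_self, Quaternion.re_coe, Quaternion.normSq_eq_norm_mul_self, sq]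

/-! ## §2 A GLOBAL one-link maximiser is critical (norm argument) -/

/-- **GLOBAL ONE-LINK MAXIMISER ⇒ EULER–LAGRANGE.** If the unit quaternion `U₀` maximises `V ↦ Re(V·S)` over the unit
sphere (the Wilson functional of the plaquettes through one link, as a function of that link's variable with its staple
sum `S` frozen), then `Re(U₀·S) = ‖S‖` and `Im(U₀·S) = 0`: the maximum of `Re(V·S)` over unit `V` is `‖S‖` (attained at
`V = S*∕‖S‖`), and `Re q = ‖q‖` forces `Im q = 0`. -/
theorem el_of_forall_re_mul_le {U₀ S : ℍ} (hU : ‖U₀‖ = 1)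
    (hmax : ∀ V : ℍ, ‖V‖ = 1 → (V * S).re ≤ (U₀ * S).re) :
    (U₀ * S).re = ‖S‖ ∧ (U₀ * S).im = 0 := by
  have hle : (U₀ * S).re ≤ ‖S‖ := re_mul_le_norm U₀ S hU
  have hge : ‖S‖ ≤ (U₀ * S).re := by
    by_cases hS : S = 0
    · simp [hS]
    · have hn : ‖S‖ ≠ 0 := norm_ne_zero_iff.mpr hS
      have hV : ‖(‖S‖⁻¹ : ℝ) • star S‖ = 1 := by
        rw [norm_smul, norm_inv, Real.norm_of_nonneg (norm_nonneg _), norm_star, inv_mul_cancel₀ hn]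
      have hVS : (((‖S‖⁻¹ : ℝ) • star S) * S).re = ‖S‖ := by
        rw [smul_mul_assoc, Quaternion.re_smul, re_star_mul_self, smul_eq_mul, sq, ← mul_assoc,
          inv_mul_cancel₀ hn, one_mul]
      have := hmax _ hV
      rwa [hVS] at this
  have heq : (U₀ * S).re = ‖S‖ := le_antisymm hle hge
  refine ⟨heq, im_eq_zero_of_norm_le_re _ ?_⟩
  rw [heq, norm_mul, hU, one_mul]

/-! ## §3 A LOCAL one-link maximiser on the sphere is critical (great-circle derivative) -/

/-- The great circle factor `cos t + sin t·Y` is a unit quaternion when `Y` is a unit pure imaginary. -/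
theorem norm_cos_add_sin_mul (Y : ℍ) (hYre : Y.re = 0) (hY : ‖Y‖ = 1) (t : ℝ) :
    ‖(Real.cos t : ℍ) + (Real.sin t : ℍ) * Y‖ = 1 := by
  have hY2 : Y.imI ^ 2 + Y.imJ ^ 2 + Y.imK ^ 2 = 1 := by
    have h := sq_norm_eq_sum_sq Y
    rw [hY, hYre] at h
    linarith
  have h : ‖(Real.cos t : ℍ) + (Real.sin t : ℍ) * Y‖ ^ 2 = 1 := by
    rw [sq_norm_eq_sum_sq, Quaternion.coe_mul_eq_smul]
    simp only [Quaternion.re_add, Quaternion.re_coe, Quaternion.re_smul, hYre, smul_eq_mul, mul_zero, add_zero,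
      Quaternion.imI_add, Quaternion.imI_coe, Quaternion.imI_smul, zero_add, Quaternion.imJ_add, Quaternion.imJ_coe,
      Quaternion.imJ_smul, Quaternion.imK_add, Quaternion.imK_coe, Quaternion.imK_smul]
    nlinarith [Real.cos_sq_add_sin_sq t]
  exact (pow_eq_one_iff_of_nonneg (norm_nonneg _) two_ne_zero).1 h

/-- **LOCAL ONE-LINK MAXIMISER ⇒ TANGENT CRITICALITY.** If the unit quaternion `U₀` is a LOCAL maximiser of
`V ↦ Re(V·S)` on the unit sphere, then `Re((X·U₀)·S) = 0` for every pure imaginary `X` — the hypothesis of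
`QuaternionBianchiDefect.critical_iff_im_eq_zero`. Proof: along the great circle `γ(t) = (cos t + sin t·X̂)·U₀`
(`X̂ = X∕‖X‖`) the function `t ↦ Re(γ(t)·S) = cos t·Re(U₀S) + sin t·Re(X̂U₀S)` has a local maximum at `t = 0`, so its
derivative `Re(X̂U₀S)` there vanishes. -/
theorem tangentCritical_of_isLocalMaxOn_sphere {U₀ S : ℍ} (hU : ‖U₀‖ = 1)
    (hmax : IsLocalMaxOn (fun V : ℍ => (V * S).re) (Metric.sphere (0 : ℍ) 1) U₀) :
    ∀ X : ℍ, X.re = 0 → ((X * U₀) * S).re = 0 := by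
  intro X hX
  by_cases hX0 : X = 0
  · simp [hX0]
  have hXn : ‖X‖ ≠ 0 := norm_ne_zero_iff.mpr hX0
  -- the unit direction `Y = X / ‖X‖`
  set Y : ℍ := (‖X‖⁻¹ : ℝ) • X with hYdef
  have hYre : Y.re = 0 := by rw [hYdef, Quaternion.re_smul, hX, smul_zero]
  have hY : ‖Y‖ = 1 := by
    rw [hYdef, norm_smul, norm_inv, Real.norm_of_nonneg (norm_nonneg _), inv_mul_cancel₀ hXn]
  -- the great circle through `U₀` in the direction `Y·U₀`
  set γ : ℝ → ℍ := fun t => ((Real.cos t : ℍ) + (Real.sin t : ℍ) * Y) * U₀ with hγ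
  have hγ0 : γ 0 = U₀ := by simp [hγ]
  have hγmem : ∀ t, γ t ∈ Metric.sphere (0 : ℍ) 1 := fun t => by
    rw [mem_sphere_zero_iff_norm, hγ, norm_mul, norm_cos_add_sin_mul Y hYre hY, hU, one_mul]
  have hγc : Continuous γ :=
    ((Quaternion.continuous_coe.comp Real.continuous_cos).add
      ((Quaternion.continuous_coe.comp Real.continuous_sin).mul continuous_const)).mul continuous_const
  have htend : Tendsto γ (𝓝 0) (𝓝[Metric.sphere (0 : ℍ) 1] (γ 0)) :=
    tendsto_nhdsWithin_iff.mpr ⟨hγc.tendsto 0, Filter.Eventually.of_forall hγmem⟩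
  -- the restriction to the great circle has a local maximum at `t = 0`
  have hloc : IsLocalMax ((fun V : ℍ => (V * S).re) ∘ γ) 0 :=
    IsMaxFilter.comp_tendsto (by rw [hγ0]; exact hmax) htend
  -- … and derivative `Re(Y·U₀·S)` there
  have hfun : ((fun V : ℍ => (V * S).re) ∘ γ) =
      fun t => Real.cos t * (U₀ * S).re + Real.sin t * ((Y * U₀) * S).re := by
    funext t
    simp only [Function.comp_apply, hγ]
    rw [add_mul, add_mul, Quaternion.re_add, mul_assoc, mul_assoc, mul_assoc, Quaternion.coe_mul_eq_smul,
      Quaternion.coe_mul_eq_smul, Quaternion.re_smul, Quaternion.re_smul, smul_eq_mul, smul_eq_mul, ← mul_assoc Y]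
  have hderiv : HasDerivAt ((fun V : ℍ => (V * S).re) ∘ γ) (((Y * U₀) * S).re) 0 := by
    have h1 := ((Real.hasDerivAt_cos 0).mul_const ((U₀ * S).re)).add
      ((Real.hasDerivAt_sin 0).mul_const (((Y * U₀) * S).re))
    simp only [Real.sin_zero, neg_zero, zero_mul, zero_add, Real.cos_zero, one_mul] at h1
    rw [hfun]
    exact h1
  have hzero : ((Y * U₀) * S).re = 0 := hloc.hasDerivAt_eq_zero hderiv
  -- `X = ‖X‖ • Y`
  have hXY : X = (‖X‖ : ℝ) • Y := by
    rw [hYdef, smul_smul, mul_inv_cancel₀ hXn, one_smul]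
  rw [hXY, smul_mul_assoc, smul_mul_assoc, Quaternion.re_smul, hzero, smul_zero]

/-- **LOCAL ONE-LINK MAXIMISER ⇒ EULER–LAGRANGE**: `Im(U₀·S) = 0` (§3 + (β₁) `critical_iff_im_eq_zero`). -/
theorem im_eq_zero_of_isLocalMaxOn_sphere {U₀ S : ℍ} (hU : ‖U₀‖ = 1)
    (hmax : IsLocalMaxOn (fun V : ℍ => (V * S).re) (Metric.sphere (0 : ℍ) 1) U₀) : (U₀ * S).im = 0 :=
  (critical_iff_im_eq_zero U₀ S).1 (tangentCritical_of_isLocalMaxOn_sphere hU hmax)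

/-- Subtype form: a local maximum of `V ↦ Re(V·S)` on the GROUP `↥(sphere 0 1)` (its own topology) is a local maximum
on the sphere as a subset of `ℍ`. -/
theorem isLocalMaxOn_of_isLocalMax_subtype {S : ℍ} {u₀ : (Metric.sphere (0 : ℍ) 1)}
    (hmax : IsLocalMax (fun V : (Metric.sphere (0 : ℍ) 1) => ((V : ℍ) * S).re) u₀) :
    IsLocalMaxOn (fun V : ℍ => (V * S).re) (Metric.sphere (0 : ℍ) 1) (u₀ : ℍ) := by
  have h : ∀ᶠ a : (Metric.sphere (0 : ℍ) 1) in 𝓝 u₀, ((a : ℍ) * S).re ≤ ((u₀ : ℍ) * S).re := hmax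
  show ∀ᶠ y in 𝓝[Metric.sphere (0 : ℍ) 1] (u₀ : ℍ), (y * S).re ≤ ((u₀ : ℍ) * S).re
  rw [nhdsWithin_eq_map_subtype_coe u₀.2, Filter.eventually_map]
  simpa only [Subtype.coe_eta] using h

/-- **LOCAL ONE-LINK MAXIMISER ON THE GROUP ⇒ EULER–LAGRANGE** (subtype form of `im_eq_zero_of_isLocalMaxOn_sphere`). -/
theorem im_eq_zero_of_isLocalMax_subtype {S : ℍ} {u₀ : (Metric.sphere (0 : ℍ) 1)}
    (hmax : IsLocalMax (fun V : (Metric.sphere (0 : ℍ) 1) => ((V : ℍ) * S).re) u₀) : ((u₀ : ℍ) * S).im = 0 :=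
  im_eq_zero_of_isLocalMaxOn_sphere (norm_coe_sphere u₀) (isLocalMaxOn_of_isLocalMax_subtype hmax)

/-! ## §4 On the lattice: one-link minimisers of the Wilson action -/

section Lattice

variable {d : ℕ}

/-- **The Wilson functional of the plaquettes through the link `(x,i)`**: `Σ_{k ≠ i} [Re P_{ik}(x) + Re P_{ik}(x − e_k)]`
(real parts — `½ Re tr` in `SU(2)` language — of the `2(d−1)` plaquettes containing the link; `= Re(U(x,i)·S(x,i))` by
`CovariantDivergenceEL.re_mul_staple`). -/
def plaqReThrough (U : ZdGaugeConfig d (Metric.sphere (0 : ℍ) 1)) (x : Site d) (i : Fin d) : ℝ :=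
  ∑ k ∈ Finset.univ.erase i,
    (((ZdGaugeConfig.plaquette U x i k : (Metric.sphere (0 : ℍ) 1)) : ℍ).re +
      ((ZdGaugeConfig.plaquette U (x - Pi.single k 1) i k : (Metric.sphere (0 : ℍ) 1)) : ℍ).re)

/-- **The Wilson action of the plaquettes through the link `(x,i)`**: `Σ_{k ≠ i} [(1 − Re P_{ik}(x)) + (1 − Re P_{ik}(x − e_k))]`
— the only part of the Wilson action `Σ_p (1 − Re U_p)` that depends on the link variable `U(x,i)`. -/
def actionThrough (U : ZdGaugeConfig d (Metric.sphere (0 : ℍ) 1)) (x : Site d) (i : Fin d) : ℝ :=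
  ∑ k ∈ Finset.univ.erase i,
    ((1 - ((ZdGaugeConfig.plaquette U x i k : (Metric.sphere (0 : ℍ) 1)) : ℍ).re) +
      (1 - ((ZdGaugeConfig.plaquette U (x - Pi.single k 1) i k : (Metric.sphere (0 : ℍ) 1)) : ℍ).re))

/-- `plaqReThrough U x i = Re(U(x,i)·S(x,i))`. -/
theorem plaqReThrough_eq (U : ZdGaugeConfig d (Metric.sphere (0 : ℍ) 1)) (x : Site d) (i : Fin d) :
    plaqReThrough U x i = ((U (x, i) : ℍ) * staple U x i).re :=
  (re_mul_staple U x i).symm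

/-- `actionThrough = 2·#{k ≠ i} − plaqReThrough`. -/
theorem actionThrough_eq (U : ZdGaugeConfig d (Metric.sphere (0 : ℍ) 1)) (x : Site d) (i : Fin d) :
    actionThrough U x i = 2 * ((Finset.univ.erase i).card : ℝ) - plaqReThrough U x i := by
  rw [actionThrough, plaqReThrough, Finset.sum_add_distrib, Finset.sum_add_distrib, Finset.sum_sub_distrib,
    Finset.sum_sub_distrib, Finset.sum_const, nsmul_eq_mul, mul_one]
  ring

/-- Replacing the link variable by `V` (the other links frozen) turns the Wilson functional through the link into
`Re(V·S(x,i))` — the staple sum does not see the link (`staple_update`). -/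
theorem plaqReThrough_update (U : ZdGaugeConfig d (Metric.sphere (0 : ℍ) 1)) (x : Site d) (i : Fin d)
    (V : (Metric.sphere (0 : ℍ) 1)) :
    plaqReThrough (Function.update U (x, i) V) x i = ((V : ℍ) * staple U x i).re := by
  rw [plaqReThrough_eq, staple_update, Function.update_self]

/-- The same for the action: `actionThrough (U with U(x,i) := V) = 2·#{k ≠ i} − Re(V·S(x,i))`. -/
theorem actionThrough_update (U : ZdGaugeConfig d (Metric.sphere (0 : ℍ) 1)) (x : Site d) (i : Fin d)
    (V : (Metric.sphere (0 : ℍ) 1)) :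
    actionThrough (Function.update U (x, i) V) x i =
      2 * ((Finset.univ.erase i).card : ℝ) - ((V : ℍ) * staple U x i).re := by
  rw [actionThrough_eq, plaqReThrough_update]

/-- Updating the link with its own value changes nothing. -/
theorem update_eq_self (U : ZdGaugeConfig d (Metric.sphere (0 : ℍ) 1)) (x : Site d) (i : Fin d) :
    Function.update U (x, i) (U (x, i)) = U :=
  Function.update_eq_self _ U

/-- **GLOBAL ONE-LINK MINIMISER OF THE WILSON ACTION ⇒ LATTICE YANG–MILLS EQUATION AT THE LINK.** If no value `V ∈ S³`
of the link variable `U(x,i)` (the other links frozen) lowers the Wilson action of the plaquettes through the link — in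
particular if `U` minimises the Wilson action over any set of free links containing `(x,i)` with the rest frozen — then
the covariant divergence of the sine-curvature vanishes at the link, `covDiv U x i = 0`, and moreover
`Re(U(x,i)·S(x,i)) = ‖S(x,i)‖` (the link variable is ALIGNED with its staple sum). ROUTES v5 §2 (β): «(β₁) … a fortiori
the minimiser». -/
theorem covDiv_eq_zero_of_forall_actionThrough_le (U : ZdGaugeConfig d (Metric.sphere (0 : ℍ) 1)) (x : Site d)
    (i : Fin d)
    (hmin : ∀ V : (Metric.sphere (0 : ℍ) 1), actionThrough U x i ≤ actionThrough (Function.update U (x, i) V) x i) :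
    covDiv U x i = 0 ∧ ((U (x, i) : ℍ) * staple U x i).re = ‖staple U x i‖ := by
  have h := el_of_forall_re_mul_le (U₀ := (U (x, i) : ℍ)) (S := staple U x i) (norm_coe_sphere _) (by
    intro V hV
    have h1 := hmin ⟨V, mem_sphere_zero_iff_norm.mpr hV⟩
    rw [actionThrough_update, actionThrough_eq, plaqReThrough_eq] at h1
    linarith)
  exact ⟨by rw [← im_mul_staple]; exact h.2, h.1⟩

/-- The same from the maximiser side: no value of the link variable raises `plaqReThrough`. -/
theorem covDiv_eq_zero_of_forall_plaqReThrough_le (U : ZdGaugeConfig d (Metric.sphere (0 : ℍ) 1)) (x : Site d)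
    (i : Fin d)
    (hmax : ∀ V : (Metric.sphere (0 : ℍ) 1), plaqReThrough (Function.update U (x, i) V) x i ≤ plaqReThrough U x i) :
    covDiv U x i = 0 ∧ ((U (x, i) : ℍ) * staple U x i).re = ‖staple U x i‖ := by
  refine covDiv_eq_zero_of_forall_actionThrough_le U x i fun V => ?_
  rw [actionThrough_eq, actionThrough_eq]
  linarith [hmax V]

/-- **LOCAL ONE-LINK MINIMISER ⇒ LATTICE YANG–MILLS EQUATION.** If the link value `U(x,i)` is only a LOCAL minimiser, on
the group `S³`, of `V ↦` the Wilson action of the plaquettes through the link with the link set to `V` (the other links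
frozen), then still `covDiv U x i = 0` (great-circle derivative, §3). -/
theorem covDiv_eq_zero_of_isLocalMin_actionThrough (U : ZdGaugeConfig d (Metric.sphere (0 : ℍ) 1)) (x : Site d)
    (i : Fin d)
    (hmin : IsLocalMin (fun V : (Metric.sphere (0 : ℍ) 1) => actionThrough (Function.update U (x, i) V) x i) (U (x, i))) :
    covDiv U x i = 0 := by
  have hmax : IsLocalMax (fun V : (Metric.sphere (0 : ℍ) 1) => ((V : ℍ) * staple U x i).re) (U (x, i)) := by
    refine Filter.Eventually.mono hmin fun V hV => ?_
    dsimp only at hV ⊢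
    rw [actionThrough_update, actionThrough_update] at hV
    linarith
  rw [← im_mul_staple]
  exact im_eq_zero_of_isLocalMax_subtype hmax

/-- Tangent-form corollary, for use with `critical_iff_covDiv_eq_zero`: a local one-link minimiser is critical along
every tangent direction of the sphere. -/
theorem tangentCritical_of_isLocalMin_actionThrough (U : ZdGaugeConfig d (Metric.sphere (0 : ℍ) 1)) (x : Site d)
    (i : Fin d)
    (hmin : IsLocalMin (fun V : (Metric.sphere (0 : ℍ) 1) => actionThrough (Function.update U (x, i) V) x i) (U (x, i))) :
    ∀ X : ℍ, X.re = 0 → ((X * (U (x, i) : ℍ)) * staple U x i).re = 0 :=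
  (critical_iff_covDiv_eq_zero U x i).2 (covDiv_eq_zero_of_isLocalMin_actionThrough U x i hmin)

end Lattice

end

end Summit.QuantumFields.BalabanUV.T4Continuum.NE7b.LinkMinimiserEL
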